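import Summits.ResolutionOfSingularities.ResolutionOfSingularities.Theorems.FrobeniusClosingPatchingRelPerfectCoreRungReductions
import Summits.ResolutionOfSingularities.ResolutionOfSingularities.Theorems.FrobeniusClosingPatchingRelPerfectCompanionKernel
import Literature.AlgebraicGeometry.Resolution.ColonIdealSheafFG
import Literature.AlgebraicGeometry.Resolution.HypersurfaceRestrictionTransform
import Literature.AlgebraicGeometry.Resolution.KollarFunctorLinearCentre
import HarnessLib

/-!
# Crux `PatchingRelPerfect` (stmt-ResolutionOfSingularities-16161), chain w52 — programme r-d1,
# piece I1 (`ExceptionalPackage`), part 1: the FORMAT of a depth-one ideal on the first blow-up,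
# globally and chart-free

[OURS · L1 W5.2 · rung tool] CHAIN.md v1.5 §2 (row stub-3), towards `ExceptionalPackage` of plan-1's
typed targets E (`…DepthOneTargets.lean`): let `S` be a local ring, `x = (x₁, …, x_n)` ANY family
spanning `𝔪`, `I` an ideal of EXCEPTIONAL DEPTH ONE (`I ⊆ 𝔪ᵈ` and `x_i^{d+1} ∈ I` for all `i`),
and `g : X ⟶ Spec S` any blowing up along `𝔪~`, with exceptional ideal `𝓘_E = 𝔪𝒪_X` (an
effective Cartier divisor).  PROVED, without charts:

* `comap_idealSheaf_span_powers_eq_pow` — `(x₁ᵃ, …, x_nᵃ)𝒪_X = 𝓘_Eᵃ` for every `a ≥ 1`: the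
  pigeonhole `(x_iᵃ) · 𝔪ᴺ = 𝔪^{a+N}` of rung r1a (`CoreRung.span_powers_mul_pow_eq_pow`) pulled back
  and the Cartier factor `𝓘_Eᴺ` cancelled (`IsEffectiveCartier.eq_of_mul_eq_mul`);
* `depthOne_format` — **the format**: with `M = 𝓘_Eᵈ` (effective Cartier) and
  `K = (I𝒪_X : 𝓘_Eᵈ)` (the controlled transform `controlledTransform g 𝔪~ I~ d`), one has
  `I𝒪_X = M · K` (`IsBlowup.pow_mul_controlledTransform_eq`) and **`𝓘_E ≤ K`**
  (`𝓘_E^{d+1} = (x_i^{d+1})𝒪_X ≤ I𝒪_X = 𝓘_Eᵈ · K`, cancel `𝓘_Eᵈ`): on a chart, `K = (w) + 𝔟̂` with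
  `w` the exceptional equation — the starting point `D0` of the dictionary;
* `support_comap_idealSheaf_maximalIdeal_subset` — the exceptional divisor lies over the closed point.

Every local ring `S` (no regularity needed for the format); nothing here is a statement of the
manuscript under review.

## References

* U. Görtz, T. Wedhorn, *Algebraic Geometry I*, 2nd ed. (2020), Prop. 13.91 (1), (13.19).
  [GortzWedhorn2020]
* J. Kollár, *Lectures on Resolution of Singularities* (2007), (3.111) Step 3. [Kollar2007]
-/

-- `Summit.<Summit>.<Sub>.Theorems` with `Sub = Summit` (single-conjunct summit, D-0017)
set_option linter.dupNamespace false

noncomputable section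

open CategoryTheory CategoryTheory.Limits AlgebraicGeometry Literature.AlgebraicGeometry.Resolution
open IsLocalRing

namespace Summit.ResolutionOfSingularities.ResolutionOfSingularities.Theorems

namespace DepthOne

universe u

variable {S : Type u} [CommRing S] {n : ℕ} (x : Fin n → S) {𝔪 : Ideal S}
  (hx : Ideal.span (Set.range x) = 𝔪) {X : Scheme.{u}} {g : X ⟶ Spec (.of S)}
  (hg : IsBlowup g (affineBlowup.idealSheaf 𝔪))

/-- Powers of affine ideal sheaves: `(Iᵃ)~ = (I~)ᵃ`. [folklore] -/
theorem idealSheaf_pow (I : Ideal S) (a : ℕ) :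
    affineBlowup.idealSheaf (I ^ a) = affineBlowup.idealSheaf I ^ a := by
  induction a with
  | zero => rw [pow_zero, pow_zero, Ideal.one_eq_top, affineBlowup.idealSheaf_top,
      Scheme.IdealSheafData.one_eq_top]
  | succ a ih => rw [pow_succ, pow_succ, affineBlowup.idealSheaf_mul, ih]

include hx hg in
/-- **`(x₁ᵃ, …, x_nᵃ)𝒪_X = 𝓘_Eᵃ`** on any blowing up of `Spec S` along `𝔪~ = (x)~` (`a ≥ 1`): pull back
r1a's pigeonhole `(x_iᵃ) · 𝔪ᴺ = 𝔪^{a+N}` and cancel the effective Cartier divisor `𝓘_Eᴺ`.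
[cite: GortzWedhorn2020, Prop. 13.91 (1)] -/
theorem comap_idealSheaf_span_powers_eq_pow {a : ℕ} (ha : 1 ≤ a) :
    (affineBlowup.idealSheaf (Ideal.span (Set.range fun i => x i ^ a))).comap g =
      (affineBlowup.idealSheaf 𝔪).comap g ^ a := by
  -- pigeonhole with `N = n * a`: `n (a - 1) < a + N`
  have hpig := CoreRung.span_powers_mul_pow_eq_pow x hx (a := a) (N := n * a)
    (by have := Nat.mul_le_mul_left n (Nat.sub_le a 1); omega)
  have h1 := congrArg (fun J : Ideal S => (affineBlowup.idealSheaf J).comap g) hpig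
  simp only [affineBlowup.idealSheaf_mul, idealSheaf_pow, comap_mul, comap_pow] at h1
  -- cancel `𝓘_E ^ (n a)`
  have hE : IsEffectiveCartier ((affineBlowup.idealSheaf 𝔪).comap g ^ (n * a)) :=
    hg.isEffectiveCartier.pow _
  apply hE.eq_of_mul_eq_mul
  rw [mul_comm, h1, pow_add, mul_comm]

include hx hg in
/-- **The depth-one FORMAT on the first blow-up** (D0 of the dictionary): for `I ⊆ 𝔪ᵈ` with
`x_i^{d+1} ∈ I` for all `i` and any blowing up `g : X ⟶ Spec S` along `𝔪~`, the ideal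
`K = (I𝒪_X : 𝓘_Eᵈ)` (controlled transform) satisfies `I𝒪_X = 𝓘_Eᵈ · K` and `𝓘_E ≤ K`, and `𝓘_Eᵈ`
is an effective Cartier divisor. [cite: GortzWedhorn2020, Prop. 13.91 (1)]
[cite: Kollar2007, (3.111) Step 3] -/
theorem depthOne_format {I : Ideal S} {d : ℕ} (hId : I ≤ 𝔪 ^ d) (hxI : ∀ i, x i ^ (d + 1) ∈ I) :
    IsEffectiveCartier ((affineBlowup.idealSheaf 𝔪).comap g ^ d) ∧
      (affineBlowup.idealSheaf 𝔪).comap g ≤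
        controlledTransform g (affineBlowup.idealSheaf 𝔪) (affineBlowup.idealSheaf I) d ∧
      (affineBlowup.idealSheaf I).comap g = (affineBlowup.idealSheaf 𝔪).comap g ^ d *
        controlledTransform g (affineBlowup.idealSheaf 𝔪) (affineBlowup.idealSheaf I) d := by
  have hEd : IsEffectiveCartier ((affineBlowup.idealSheaf 𝔪).comap g ^ d) :=
    hg.isEffectiveCartier.pow d
  have hle : (affineBlowup.idealSheaf I).comap g ≤ (affineBlowup.idealSheaf 𝔪).comap g ^ d := by
    rw [← comap_pow, ← idealSheaf_pow]
    exact Scheme.IdealSheafData.comap_mono g (affineBlowup.idealSheaf_le_idealSheaf_iff.mpr hId)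
  have hfmt := hg.pow_mul_controlledTransform_eq hle
  refine ⟨hEd, ?_, hfmt.symm⟩
  -- `𝓘_E^{d+1} = (x_i^{d+1})𝒪 ≤ I𝒪 = 𝓘_E^d · K`; cancel `𝓘_E^d`
  apply hEd.le_of_mul_le_mul
  rw [← pow_succ, hfmt, ← comap_idealSheaf_span_powers_eq_pow x hx hg (Nat.succ_pos d)]
  refine Scheme.IdealSheafData.comap_mono g (affineBlowup.idealSheaf_le_idealSheaf_iff.mpr ?_)
  rw [Ideal.span_le]
  rintro _ ⟨i, rfl⟩
  exact hxI i

/-- **The exceptional divisor lies over the closed point**: every point of the support of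
`𝔪𝒪_X` maps to the closed point of the local ring `S`. [folklore] -/
theorem support_comap_idealSheaf_maximalIdeal_subset [IsLocalRing S]
    (h𝔪 : 𝔪 = IsLocalRing.maximalIdeal S) (y : X)
    (hy : y ∈ ((affineBlowup.idealSheaf 𝔪).comap g).support) :
    g.base y = IsLocalRing.closedPoint S := by
  rw [Scheme.IdealSheafData.support_comap] at hy
  exact support_idealSheaf_subset_closedPoint (Q := 𝔪) (n := 1) (by rw [h𝔪, pow_one]) _ hy

end DepthOne

end Summit.ResolutionOfSingularities.ResolutionOfSingularities.Theorems

end
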